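import Literature.Barriers.Parity.SiegelZeroDichotomyPairHLProp81Final2
import Literature.Barriers.Parity.SiegelZeroDichotomyPairHLProp81Final1
import Literature.Barriers.Parity.SiegelZeroDichotomyPairHLKernelCrude
import Literature.NumberTheory.Sieve.SingularSeriesRate
import Literature.NumberTheory.Sieve.DivisorBound
import Literature.Barriers.Parity.SiegelZeroDichotomyPairHLProp81Singular
import Literature.Barriers.Parity.SiegelZeroDichotomyPairHLProp72
import HarnessLib

/-!
# Tao–Teräväinen 2022, Propositions 7.2 and 8.1 (`k = 2`): the named fact, from the kernel bounds

Topic `Literature/Barriers/Parity`, sub-namespace `TaoTeravainen`; the FINAL assembly of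
`Literature.Barriers.Parity.TaoTeravainen2021_prop72_81_pair` (T. Tao, J. Teräväinen, *The
Hardy–Littlewood–Chowla conjecture in the presence of a Siegel zero*, J. London Math. Soc. (2) 106 (2022),
arXiv:2109.06291), Propositions 7.2 and 8.1 combined at `k = 2`:
`𝔼_{n≤x} Λ_Siegel(n+h₁)Λ_Siegel(n+h₂) = 𝔖 + O(log^{-1/20} η)` on `q^{20.5+ε₀} ≤ x ≤ q^{√η}`.
Everything here is PROVED, from: `prop72_pair` (Prop. 7.2), `abs_sharpCorr_sub_smooth_le` (the
`χ`-twisted terms) with `lemma37_pair_*`, `abs_sharpCorr_sub_le_of_kernelBounds` (the §8 main term), the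
crude kernel bound `kernel_KB1`, the parameter/size bookkeeping (`…Prop81Params/Final1/Final2.lean`), and
the two remaining kernel bounds of §8 — the refined bound (8.20) and the asymptotic (8.25) for
`∏_{p ≤ x} E_p(τ)` — which enter as the HYPOTHESES `hKB2`, `hKB3` of
`prop72_81_pair_of_kernelBounds`. [cite: TaoTeravainen2021, Propositions 7.2, 8.1 and §8 (8.20), (8.25)]
-/

noncomputable section

open Finset Real MeasureTheory Complex
open scoped FourierTransform

namespace Literature.Barriers.Parity

namespace TaoTeravainen

open Literature.NumberTheory.Sieve (singularSeries singularSeriesPartial singularSeriesFactor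
  exists_abs_singularSeries_sub_partial_le exists_card_divisors_le_mul_rpow)


/-! ### Small helpers -/

/-- `polyWeight` is monotone in the exponent (`X ≥ 0`). [folklore] -/
theorem polyWeight_mono {X : ℝ} (hX : 0 ≤ X) {κ κ' : ℕ} (h : κ ≤ κ') (τ : Slot → ℝ) :
    polyWeight X κ τ ≤ polyWeight X κ' τ := by
  unfold polyWeight
  refine prod_le_prod (fun k _ => zero_le_one.trans (one_le_slotPoly hX κ k (τ k))) fun k _ => ?_
  unfold slotPoly
  split_ifs
  · exact pow_le_pow_right₀ (by have := abs_nonneg (τ k); nlinarith) h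
  · exact pow_le_pow_right₀ (by have := abs_nonneg (τ k); linarith) h

/-- `1 < R` for `x > 1`, `η > 1`. [folklore] -/
theorem one_lt_pairScaleR {η x : ℝ} (hη : 1 < η) (hx : 1 < x) : 1 < pairScaleR η x :=
  Real.one_lt_rpow hx (by have := Real.rpow_pos_of_pos (Real.log_pos hη) ((1 : ℝ) / 10); positivity)

/-- `R ≤ x^c` once `log^{1/10} η ≥ 1/c` (`x ≥ 1`, `c > 0`). [folklore] -/
theorem pairScaleR_le_rpow {η x c : ℝ} (hη : 1 < η) (hx : 1 ≤ x) (hc : 0 < c) (hηc : 1 / c ≤ Real.log η ^ ((1 : ℝ) / 10)) :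
    pairScaleR η x ≤ x ^ c := by
  unfold pairScaleR
  refine Real.rpow_le_rpow_of_exponent_le hx ?_
  have hpos : 0 < Real.log η ^ ((1 : ℝ) / 10) := Real.rpow_pos_of_pos (Real.log_pos hη) _
  rw [div_le_iff₀ hpos, ← div_le_iff₀' hc]; exact hηc

/-- `R ≤ x` (`x ≥ 1`, `η ≥ e`). [folklore] -/
theorem pairScaleR_le_self {η x : ℝ} (hη : Real.exp 1 ≤ η) (hx : 1 ≤ x) : pairScaleR η x ≤ x := by
  unfold pairScaleR
  have hL : 1 ≤ Real.log η := by rw [← Real.log_exp 1]; exact Real.log_le_log (Real.exp_pos 1) hη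
  have h1 : 1 ≤ Real.log η ^ ((1 : ℝ) / 10) := Real.one_le_rpow hL (by norm_num)
  calc x ^ (1 / Real.log η ^ ((1 : ℝ) / 10)) ≤ x ^ (1 : ℝ) :=
        Real.rpow_le_rpow_of_exponent_le hx ((div_le_one (by linarith)).mpr h1)
    _ = x := Real.rpow_one x

/-- Range facts from `q^{41/2+ε₀} ≤ x` (`q ≥ 3`, `ε₀ ≥ 0`, `x ≥ 1` natural): `q^{41/2} ≤ x`, `q ≤ x`,
`log q ≤ log x/20`, `q ≤ x^{1/20}`, `20 ≤ log x`. [folklore] -/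
theorem range_facts {q x : ℕ} (hq : 3 ≤ q) {ε₀ : ℝ} (hε₀ : 0 ≤ ε₀) (hx : (q : ℝ) ^ ((41 : ℝ) / 2 + ε₀) ≤ x) :
    (q : ℝ) ^ ((41 : ℝ) / 2) ≤ x ∧ (q : ℝ) ≤ x ∧ Real.log q ≤ Real.log x / 20 ∧ (q : ℝ) ≤ (x : ℝ) ^ ((1 : ℝ) / 20) ∧
      20 ≤ Real.log x ∧ (1 : ℝ) < x := by
  have hq1 : (1 : ℝ) < q := by exact_mod_cast lt_of_lt_of_le (by norm_num) hq
  have hq0 : (0 : ℝ) < q := by linarith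
  have h1 : (q : ℝ) ^ ((41 : ℝ) / 2) ≤ x := (Real.rpow_le_rpow_of_exponent_le hq1.le (by linarith)).trans hx
  have hqx : (q : ℝ) ≤ x := by
    calc (q : ℝ) = (q : ℝ) ^ (1 : ℝ) := (Real.rpow_one _).symm
      _ ≤ (q : ℝ) ^ ((41 : ℝ) / 2) := Real.rpow_le_rpow_of_exponent_le hq1.le (by norm_num)
      _ ≤ x := h1
  have hx0 : (0 : ℝ) < x := by linarith
  have hx1 : (1 : ℝ) < x := by linarith
  have hlog : (41 : ℝ) / 2 * Real.log q ≤ Real.log x := by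
    rw [← Real.log_rpow hq0]; exact Real.log_le_log (by positivity) h1
  have hlogq0 : 0 < Real.log q := Real.log_pos hq1
  have hlog3 : 1 < Real.log q := by
    have h3 : Real.log 3 ≤ Real.log q := Real.log_le_log (by norm_num) (by exact_mod_cast hq)
    have : 1 < Real.log 3 := by
      rw [← Real.log_exp 1]; refine Real.log_lt_log (Real.exp_pos 1) ?_; have := Real.exp_one_lt_d9; linarith
    linarith
  refine ⟨h1, hqx, by linarith, ?_, by linarith, hx1⟩
  -- `q ≤ x^{1/20}` from `q^{20} ≤ q^{41/2} ≤ x`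
  have h20 : (q : ℝ) ^ (20 : ℝ) ≤ x := (Real.rpow_le_rpow_of_exponent_le hq1.le (by norm_num)).trans h1
  calc (q : ℝ) = ((q : ℝ) ^ (20 : ℝ)) ^ ((1 : ℝ) / 20) := by rw [← Real.rpow_mul hq0.le]; norm_num
    _ ≤ (x : ℝ) ^ ((1 : ℝ) / 20) := Real.rpow_le_rpow (by positivity) h20 (by norm_num)

/-- `2ε + ε² ≤ (2B + B²) X^{-7/10}` when `0 ≤ ε ≤ B X^{-7/10}`, `X ≥ 1`. [folklore] -/
theorem two_mul_add_sq_le {ε B X : ℝ} (hε : 0 ≤ ε) (hX : 1 ≤ X) (h : ε ≤ B * X ^ (-(7 : ℝ) / 10)) :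
    2 * ε + ε ^ 2 ≤ (2 * B + B ^ 2) * X ^ (-(7 : ℝ) / 10) := by
  have hX0 : 0 < X := by linarith
  have hy : 0 < X ^ (-(7 : ℝ) / 10) := Real.rpow_pos_of_pos hX0 _
  have hy1 : X ^ (-(7 : ℝ) / 10) ≤ 1 := Real.rpow_le_one_of_one_le_of_nonpos hX (by norm_num)
  have h2 : ε ^ 2 ≤ B ^ 2 * X ^ (-(7 : ℝ) / 10) := by
    calc ε ^ 2 ≤ (B * X ^ (-(7 : ℝ) / 10)) ^ 2 := pow_le_pow_left₀ hε h 2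
      _ = B ^ 2 * X ^ (-(7 : ℝ) / 10) * X ^ (-(7 : ℝ) / 10) := by ring
      _ ≤ B ^ 2 * X ^ (-(7 : ℝ) / 10) * 1 := mul_le_mul_of_nonneg_left hy1 (by positivity)
      _ = _ := mul_one _
  nlinarith

set_option maxHeartbeats 4000000 in
/-- **Propositions 7.2 + 8.1 at `k = 2`, from the two kernel bounds.** `hKB2` is the refined bound
(8.20) on the box `|t| ≤ X^{1/20}` and `hKB3` the asymptotic (8.25) on the box `|t| ≤ log^{1/200} η`, for
the kernel `assemblyKernel` (every `A ≥ 1`), uniformly over Siegel zeros with `η` large and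
`q^{41/2} ≤ x ≤ q^{√η}`. [cite: TaoTeravainen2021, Propositions 7.2 and 8.1] -/
theorem prop72_81_pair_of_kernelBounds
    (hKB2 : ∀ h₁ h₂ : ℕ, 1 ≤ h₁ → 1 ≤ h₂ → h₁ ≠ h₂ →
      ∃ κ : ℕ, 2 ≤ κ ∧ ∃ C₂ c₂ η₂ : ℝ, 0 ≤ C₂ ∧ 0 ≤ c₂ ∧
        ∀ (q : ℕ) [NeZero q] (χ : DirichletCharacter ℂ q) (η : ℝ), IsSiegelZero χ η → η₂ ≤ η →
          ∀ x : ℕ, (q : ℝ) ^ ((41 : ℝ) / 2) ≤ x → (x : ℝ) ≤ (q : ℝ) ^ Real.sqrt η →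
            ∀ A : ℕ, 1 ≤ A → ∀ τ : Slot → ℝ,
              (∀ k, |τ k| ≤ boxThr (Real.log x) ((Real.log x) ^ ((1 : ℝ) / 20)) k) →
                ‖assemblyKernel χ h₁ h₂ η x A τ‖ ≤
                  C₂ * (Real.log η) ^ c₂ * ((Real.log x) ^ 2)⁻¹ * polyWeight (Real.log x) κ τ)
    (hKB3 : ∀ h₁ h₂ : ℕ, 1 ≤ h₁ → 1 ≤ h₂ → h₁ ≠ h₂ →
      ∃ κ : ℕ, 2 ≤ κ ∧ ∃ C₃ η₃ : ℝ, 0 ≤ C₃ ∧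
        ∀ (q : ℕ) [NeZero q] (χ : DirichletCharacter ℂ q) (η : ℝ), IsSiegelZero χ η → η₃ ≤ η →
          ∀ x : ℕ, (q : ℝ) ^ ((41 : ℝ) / 2) ≤ x → (x : ℝ) ≤ (q : ℝ) ^ Real.sqrt η →
            ∀ A : ℕ, 1 ≤ A → ∀ τ : Slot → ℝ,
              (∀ k, |τ k| ≤ boxThr (Real.log x) ((Real.log η) ^ ((1 : ℝ) / 200)) k) →
                ‖assemblyKernel χ h₁ h₂ η x A τ -
                    ((singularSeriesPartial ({(h₁ : ℤ), (h₂ : ℤ)} : Finset ℤ) x : ℝ) : ℂ) *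
                      ∏ j : Fin 2, eulerTrunc (x + 1) (zetaSlotS (Real.log x) (τ (j, 0)))‖ ≤
                  C₃ * (Real.log η) ^ (-(1 : ℝ) / 14) * ((Real.log x) ^ 2)⁻¹ * polyWeight (Real.log x) κ τ) :
    TaoTeravainen2021_prop72_81_pair := by
  intro h₁ h₂ hh₁ hh₂ hne ψ hψ
  classical
  /- ───── fixed data ───── -/
  set φ := stdBump with hφdef
  have hφ : IsBump φ := isBump_stdBump
  obtain ⟨B₀, hB₀0, hB₀⟩ := hφ.exists_bound
  obtain ⟨B₁, hB₁0, hB₁⟩ := hφ.exists_bound_deriv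
  obtain ⟨Bψ, hBψ0, hBψ⟩ := hψ.exists_abs_le
  choose M hM0 hM using hψ.exists_bound_iteratedDeriv'
  choose Cs hCs0 hCs using fun n => sieveFourier_decay hψ n
  obtain ⟨C₀, hC₀1, hζ₀⟩ := exists_bound_riemannZeta₀
  set H : ℕ := max h₁ h₂ with hHdef
  set H2 : Finset ℤ := ({(h₁ : ℤ), (h₂ : ℤ)} : Finset ℤ) with hH2
  obtain ⟨N₀, C𝔖, hC𝔖0, h𝔖⟩ := exists_abs_singularSeries_sub_partial_le H2
  set S𝔖 : ℝ := |singularSeries H2| + C𝔖 + 1 with hS𝔖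
  obtain ⟨Cτ, hCτ1, hCτ⟩ := exists_card_divisors_le_mul_rpow (show (0 : ℝ) < 1 / 64 by norm_num)
  obtain ⟨Cb, hCb0, hCb⟩ := lemma37_pair_both hh₁ hh₂ hne (show (0 : ℝ) < 1 / 8 by norm_num)
  obtain ⟨Cl, hCl0, hCl⟩ := lemma37_pair_left hh₁ hh₂ hne (show (0 : ℝ) < 1 / 8 by norm_num)
  obtain ⟨Cr, hCr0, hCr⟩ := lemma37_pair_right hh₁ hh₂ hne (show (0 : ℝ) < 1 / 8 by norm_num)
  set K37 : ℝ := Cb + Cl + Cr with hK37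
  obtain ⟨κ₂, hκ₂, C₂, c₂, η₂, hC₂0, hc₂0, hK2⟩ := hKB2 h₁ h₂ hh₁ hh₂ hne
  obtain ⟨κ₃, hκ₃, C₃, η₃, hC₃0, hK3⟩ := hKB3 h₁ h₂ hh₁ hh₂ hne
  set κ : ℕ := max κ₂ κ₃ with hκdef
  obtain ⟨nd, hnd1, hnd2⟩ : ∃ nd : ℕ, (nd : ℝ) / 200 - c₂ ≥ 1 / 20 ∧ (574 : ℝ) ≤ nd := by
    refine ⟨20 * ⌈c₂⌉₊ * 10 + 600, ?_, ?_⟩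
    · have h1 : c₂ ≤ ⌈c₂⌉₊ := Nat.le_ceil c₂
      push_cast; linarith only [h1]
    · have h0 : (0 : ℝ) ≤ ⌈c₂⌉₊ := Nat.cast_nonneg _
      push_cast; linarith only [h0]
  /- ───── ε₀ ───── -/
  refine ⟨1 / 100, by norm_num, fun ε₀ hε₀ hε₀1 => ?_⟩
  have hε₀20 : ε₀ ≤ 1 / 20 := by linarith
  obtain ⟨c, hc, C72, hC72, x₀, h72⟩ := prop72_pair hφ hψ hε₀ hε₀1 H
  set c' : ℝ := min c (1 / 100) with hc'
  have hc'0 : 0 < c' := lt_min hc (by norm_num)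
  have hc'c : c' ≤ c := min_le_left _ _
  have hc'1 : c' ≤ 1 / 100 := min_le_right _ _
  /- ───── absorption constants ───── -/
  obtain ⟨Ka, hKa0, hKa⟩ := exists_absorb_rpow_x 0 hc'0
  obtain ⟨Kb', hKb'0, hKb'⟩ := exists_absorb_rpow_conductor 20 (show (0 : ℝ) < 1 / 4 by norm_num)
  obtain ⟨Kc, hKc0, hKc⟩ := exists_absorb_rpow_x 20 (show (0 : ℝ) < 1 / 2 by norm_num)
  obtain ⟨Kd, hKd0, hKd⟩ := exists_absorb_rpow_x 18 (show (0 : ℝ) < ε₀ ^ 2 by positivity)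
  obtain ⟨Ke, hKe0, hKe⟩ := exists_absorb_rpow_x 0 (show (0 : ℝ) < 1 by norm_num)
  obtain ⟨Kf, hKf0, hKf⟩ := exists_absorb_log_x
  /- ───── thresholds ───── -/
  set XC : ℝ := (2 * C₀ * (1 + 2 * π)) ^ ((10 : ℝ) / 9) with hXC
  set Q₀ : ℝ := max (max (max (x₀ : ℝ) (N₀ : ℝ)) (max (H : ℝ) 200)) (Real.exp XC) with hQ₀
  obtain ⟨ηQ, hηQ⟩ := exists_eta_threshold_conductor Q₀
  set η₁ : ℝ := max (max ηQ (Real.exp ((1 / c') ^ (10 : ℝ)))) (max (max η₂ η₃) (Real.exp (Real.exp 1))) with hη₁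
  -- the final constant (assembled from the pieces below)
  set A₁c : ℝ := 972 ^ (shiftDiff h₁ h₂).primeFactors.card * Real.exp (26 * 4) * 2 ^ 26 with hA₁c
  set Kχ : ℝ := ((B₀ * (6 + Bψ)) ^ 2 + 2 * (B₀ * (6 + Bψ)) * (9 * Bψ * (B₀ + 17 * B₁))) * Bψ ^ 4 * K37 *
    ((Cτ ^ 8) * (9 ^ 8) ^ 2 + (4 * Real.exp 1) ^ 2) with hKχ
  set Kcrt : ℝ := Bψ ^ 4 * (9 * Bψ * (B₀ + 17 * B₁)) ^ 2 * (4 * Real.exp 1) ^ 2 with hKcrt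
  set Kmob : ℝ := 2 * moebiusErrConst M C₀ ε₀ + moebiusErrConst M C₀ ε₀ ^ 2 with hKmob
  set Kker₃ : ℝ := C₃ * prodIConst M Cs ε₀ κ with hKker₃
  set Kker₂ : ℝ := (C₂ + S𝔖 * modelA₄) * tailConst M Cs ε₀ κ nd * (40 * π / ε₀) ^ nd with hKker₂
  set Kker₁ : ℝ := A₁c * tailConst M Cs ε₀ κ nd * (40 * π / ε₀) ^ nd * 2 ^ 28 with hKker₁
  set Kcru : ℝ := Bψ ^ 4 * (Int.natAbs ((h₁ : ℤ) - h₂) : ℝ) * (2 * Bψ * B₀) ^ 2 * 6 ^ 2 * ((9 : ℝ) ^ 8) ^ 2 + S𝔖 with hKcru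
  refine ⟨3 * C72 * Ka + Kχ * (Kb' + Kc) + Kcrt * Kc + (Kker₃ + Kker₂) + (Kker₁ + S𝔖 * Kmob) * Kf + Kcru * Kd + (C𝔖 + 1) * Ke,
    η₁, fun q _ χ η hS hη x hxlo hxhi => ?_⟩
  /- ───── the instance: basic range facts ───── -/
  have hη₂ : η₂ ≤ η := le_trans (le_max_left _ _ |>.trans (le_max_left _ _) |>.trans (le_max_right _ _)) hη
  have hη₃ : η₃ ≤ η := le_trans (le_max_right _ _ |>.trans (le_max_left _ _) |>.trans (le_max_right _ _)) hη
  have hηQ' : ηQ ≤ η := le_trans ((le_max_left _ _).trans (le_max_left _ _)) hη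
  have hηc : Real.exp ((1 / c') ^ (10 : ℝ)) ≤ η := le_trans ((le_max_right _ _).trans (le_max_left _ _)) hη
  have hηe : Real.exp (Real.exp 1) ≤ η := le_trans ((le_max_right _ _).trans (le_max_right _ _)) hη
  have hq3 : 3 ≤ q := hS.three_le
  have hχq : χ.IsQuadratic := hS.2.1
  have hη10 := hS.ten_le
  have hη1 : (1 : ℝ) < η := by linarith
  have hηe1 : Real.exp 1 ≤ η := le_trans (Real.exp_le_exp.mpr (by have := Real.add_one_le_exp (1:ℝ); linarith)) hηe
  have hLη : 1 ≤ Real.log η := one_le_log_eta hS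
  obtain ⟨hx41, hqx, hlogq, hqx20, hX20, hx1⟩ := range_facts hq3 hε₀.le hxlo
  have hQq : Q₀ ≤ q := hηQ q χ η hS hηQ'
  have hxQ : Q₀ ≤ x := hQq.trans hqx
  have hx₀x : x₀ ≤ x := by
    have : (x₀ : ℝ) ≤ x := le_trans ((le_max_left _ _).trans ((le_max_left _ _).trans (le_max_left _ _))) hxQ
    exact_mod_cast this
  have hN₀x : N₀ ≤ x := by
    have : (N₀ : ℝ) ≤ x := le_trans ((le_max_right _ _).trans ((le_max_left _ _).trans (le_max_left _ _))) hxQ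
    exact_mod_cast this
  have hHx : H ≤ x := by
    have : (H : ℝ) ≤ x := le_trans ((le_max_left _ _).trans ((le_max_right _ _).trans (le_max_left _ _))) hxQ
    exact_mod_cast this
  have hx200 : (200 : ℝ) ≤ x := le_trans ((le_max_right _ _).trans ((le_max_right _ _).trans (le_max_left _ _))) hxQ
  have hxXC : Real.exp XC ≤ x := le_trans (le_max_right _ _) hxQ
  have hxnat1 : 1 ≤ x := by exact_mod_cast hx1.le
  have hx0 : (0 : ℝ) < x := by linarith
  set X : ℝ := Real.log x with hXdef
  have hX1 : 1 ≤ X := by linarith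
  have hX0 : 0 < X := by linarith
  have hXCX : XC ≤ X := by rw [hXdef, ← Real.log_exp XC]; exact Real.log_le_log (Real.exp_pos _) hxXC
  /- parameters -/
  set U₀ : ℝ := ppU ε₀ q x with hU₀def
  have hU₀eq : U₀ = ε₀ / 20 * Real.log x + 2 * Real.log q := rfl
  obtain ⟨hU2, hU3, hU22⟩ := pp_flat (ε₀ := ε₀) (q := q) (x := x) hX20 hq3 hlogq hε₀ hε₀1
  have hU1 : (1 : ℝ) ≤ U₀ := by linarith
  have hU0 : (0 : ℝ) < U₀ := by linarith
  have hUlo : ε₀ / 20 * X ≤ U₀ := by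
    rw [hU₀eq]; have : 0 ≤ Real.log q := Real.log_nonneg (by exact_mod_cast (by omega : 1 ≤ q)); linarith
  have hUhi : U₀ ≤ X / 3 := by linarith
  set R : ℝ := pairScaleR η x with hRdef
  have hR1 : 1 < R := one_lt_pairScaleR hη1 hx1
  have hR0 : 0 ≤ R := by linarith
  have hRc' : R ≤ (x : ℝ) ^ c' := by
    refine pairScaleR_le_rpow hη1 hx1.le hc'0 ?_
    have : (1 / c') ^ (10 : ℝ) ≤ Real.log η := by
      rw [← Real.log_exp ((1 / c') ^ (10 : ℝ))]; exact Real.log_le_log (Real.exp_pos _) hηc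
    calc 1 / c' = ((1 / c') ^ (10 : ℝ)) ^ ((1 : ℝ) / 10) := by
          rw [← Real.rpow_mul (by positivity)]; norm_num
      _ ≤ Real.log η ^ ((1 : ℝ) / 10) := Real.rpow_le_rpow (by positivity) this (by norm_num)
  have hRc : R ≤ (x : ℝ) ^ c := hRc'.trans (Real.rpow_le_rpow_of_exponent_le hx1.le hc'c)
  have hRx : R ≤ x := pairScaleR_le_self hηe1 hx1.le
  have hceilR : ⌈R⌉₊ ≤ x := Nat.ceil_le.mpr hRx
  set Dmax : ℕ := ppDmax ε₀ q x H with hDdef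
  set Bmax : ℕ := ppBmax ε₀ q x with hBdef
  set x₁ : ℕ := ppx₁ ε₀ x with hx₁def
  have hh₁H : h₁ ≤ H := le_max_left _ _
  have hh₂H : h₂ ≤ H := le_max_right _ _
  have hh₁x : h₁ ≤ x := hh₁H.trans hHx
  have hh₂x : h₂ ≤ x := hh₂H.trans hHx
  have hxX₁ : Real.log ((x + h₁ : ℕ) : ℝ) ≤ X + 1 := pp_log_add_le hxnat1 hh₁x
  have hxX₂ : Real.log ((x + h₂ : ℕ) : ℝ) ≤ X + 1 := pp_log_add_le hxnat1 hh₂x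
  /- ───── Proposition 7.2 ───── -/
  have h72x := h72 x hx₀x q χ hχq hqx20 R hR1 hRc
  obtain ⟨h72a, h72c⟩ := h72x h₁ h₂ hh₁H hh₂H hne
  obtain ⟨h72b, -⟩ := h72x h₂ h₁ hh₂H hh₁H hne.symm
  have hflat : |∑ n ∈ Icc 1 x, vonMangoldtSiegel χ ψ R (n + h₁) * vonMangoldtSiegel χ ψ R (n + h₂) -
      ∑ n ∈ Icc 1 x, vonMangoldtSiegelSharp χ φ ψ X U₀ R (n + h₁) * vonMangoldtSiegelSharp χ φ ψ X U₀ R (n + h₂)| ≤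
      3 * (C72 * (x : ℝ) ^ (1 - c)) :=
    abs_pairSum_sub_sharpSum_le χ φ ψ X U₀ R (Icc 1 x) h₁ h₂ h72a h72b h72c
  /- ───── the χ-twisted terms (Lemma 3.7) ───── -/
  obtain ⟨Kb, hKb⟩ : ∃ Kb : ℝ, Kb = Cb * (q : ℝ) ^ ((1 : ℝ) / 2 + 1 / 8) := ⟨_, rfl⟩
  obtain ⟨Kl, hKl⟩ : ∃ Kl : ℝ, Kl = Cl * (q : ℝ) ^ ((1 : ℝ) / 2 + 1 / 8) := ⟨_, rfl⟩
  obtain ⟨Kr, hKr⟩ : ∃ Kr : ℝ, Kr = Cr * (q : ℝ) ^ ((1 : ℝ) / 2 + 1 / 8) := ⟨_, rfl⟩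
  have hq0 : (0 : ℝ) < q := by exact_mod_cast (by omega : 0 < q)
  have hKb0 : 0 ≤ Kb := by rw [hKb]; positivity
  have hKl0 : 0 ≤ Kl := by rw [hKl]; positivity
  have hKr0 : 0 ≤ Kr := by rw [hKr]; positivity
  have hχE := abs_sharpCorr_sub_smooth_le χ hφ hψ hB₀ hB₁ hBψ hU2 (by linarith : 2 * U₀ ≤ X) hR1 hxX₁ hxX₂
    (Bmax := Bmax) (Dmax := Dmax) (fun b hb => pp_Bmax hb)
    (fun n hn d _ hd => pp_divisor_log_le hh₁H hxnat1 hn hd) (fun n hn d _ hd => pp_divisor_log_le hh₂H hxnat1 hn hd)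
    hKb0 hKl0 hKr0
    (fun L₁ L₂ b₁ b₂ hL₁ hL₂ hb₁ hb₂ => by
      have := hCb q χ η hS x L₁ L₂ b₁ b₂ hL₁ hL₂ hb₁ hb₂; rw [hKb]; linarith [this])
    (fun N' L₁ L₂ b₁ hL₁ hL₂ hb₁ => by
      have := hCl q χ η hS N' L₁ L₂ b₁ hL₁ hL₂ hb₁; rw [hKl]; linarith [this])
    (fun N' L₁ L₂ b₂ hL₁ hL₂ hb₂ => by
      have := hCr q χ η hS N' L₁ L₂ b₂ hL₁ hL₂ hb₂; rw [hKr]; linarith [this])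
  /- ───── the kernel bounds and the §8 assembly ───── -/
  set A : ℕ := Dmax + 1 with hAdef
  obtain ⟨hA1, hAD⟩ := pp_A Dmax
  have hDreal : (Dmax : ℝ) ≤ 4 * Real.exp 1 * (x : ℝ) ^ (ε₀ / 10) * (q : ℝ) ^ 4 :=
    ppDmax_le hε₀.le (by omega : 1 ≤ q) hxnat1 hHx
  have h4e : 4 * Real.exp 1 ≤ (x : ℝ) ^ ((1 : ℝ) / 2) := by
    have he2 : Real.exp 1 ^ 2 < 74 / 10 := by nlinarith only [Real.exp_one_lt_d9, Real.exp_pos 1]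
    have h1 : (4 * Real.exp 1) ^ 2 ≤ (x : ℝ) := by
      have : (4 * Real.exp 1) ^ 2 = 16 * Real.exp 1 ^ 2 := by ring
      linarith only [this, he2, hx200]
    calc 4 * Real.exp 1 = ((4 * Real.exp 1) ^ 2) ^ ((1 : ℝ) / 2) := by
          rw [← Real.rpow_natCast _ 2, ← Real.rpow_mul (by positivity)]; norm_num
      _ ≤ (x : ℝ) ^ ((1 : ℝ) / 2) := Real.rpow_le_rpow (by positivity) h1 (by norm_num)
  have hq4 : (q : ℝ) ^ 4 ≤ (x : ℝ) ^ ((1 : ℝ) / 5) := by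
    calc (q : ℝ) ^ 4 ≤ ((x : ℝ) ^ ((1 : ℝ) / 20)) ^ 4 := pow_le_pow_left₀ hq0.le hqx20 4
      _ = (x : ℝ) ^ ((1 : ℝ) / 5) := by rw [← Real.rpow_natCast _ 4, ← Real.rpow_mul hx0.le]; norm_num
  have hxε : (x : ℝ) ^ (ε₀ / 10) ≤ (x : ℝ) ^ ((1 : ℝ) / 10) := Real.rpow_le_rpow_of_exponent_le hx1.le (by linarith)
  have hDx' : 4 * Real.exp 1 * (x : ℝ) ^ (ε₀ / 10) * (q : ℝ) ^ 4 ≤ x := by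
    calc 4 * Real.exp 1 * (x : ℝ) ^ (ε₀ / 10) * (q : ℝ) ^ 4 ≤ (x : ℝ) ^ ((1 : ℝ) / 2) * (x : ℝ) ^ ((1 : ℝ) / 10) * (x : ℝ) ^ ((1 : ℝ) / 5) := by
          gcongr
      _ = (x : ℝ) ^ ((4 : ℝ) / 5) := by rw [← Real.rpow_add hx0, ← Real.rpow_add hx0]; norm_num
      _ ≤ (x : ℝ) ^ (1 : ℝ) := Real.rpow_le_rpow_of_exponent_le hx1.le (by norm_num)
      _ = x := Real.rpow_one _
  have hDx : Dmax ≤ x := by exact_mod_cast hDreal.trans hDx'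
  have hNmax : max Dmax ⌈R⌉₊ < x + 1 := Nat.lt_succ_of_le (max_le hDx hceilR)
  have hNX : Real.exp X < ((x + 1 : ℕ) : ℝ) := by rw [hXdef, Real.exp_log hx0]; push_cast; linarith
  have hτ₀ : 0 < X ^ (-(9 : ℝ) / 10) := Real.rpow_pos_of_pos hX0 _
  have hsmall : X⁻¹ + 2 * π * X ^ (-(9 : ℝ) / 10) ≤ 1 / (2 * C₀) :=
    pp_small hX1 (by linarith) (by
      calc 2 * C₀ * (1 + 2 * π) = XC ^ ((9 : ℝ) / 10) := by
            rw [hXC, ← Real.rpow_mul (by positivity)]; norm_num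
        _ ≤ X ^ ((9 : ℝ) / 10) := Real.rpow_le_rpow (by positivity) hXCX (by norm_num))
  obtain ⟨hL0, hLD, hLx₁⟩ := pp_L (ε₀ := ε₀) (q := q) hxnat1 hHx hh₁x (by linarith : 0 ≤ ppU ε₀ q x)
  obtain ⟨-, -, hLx₂⟩ := pp_L (ε₀ := ε₀) (q := q) hxnat1 hHx hh₂x (by linarith : 0 ≤ ppU ε₀ q x)
  set S' : ℝ := singularSeriesPartial H2 x with hS'def
  have hS'eq : ((S' : ℝ) : ℂ) = ((∏ p ∈ Nat.primesBelow (x + 1), singularSeriesFactor H2 p : ℝ) : ℂ) := by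
    rw [hS'def, ← singularSeriesPartial_eq_prod_primesBelow H2 (Nat.succ_le_succ (Nat.zero_le x)), Nat.succ_sub_one]
  have h𝔖x : |singularSeries H2 - S'| ≤ C𝔖 / x := h𝔖 x hN₀x
  have hS'le : |S'| ≤ S𝔖 := by
    have h1 : |S'| ≤ |singularSeries H2| + C𝔖 / x := by
      have := abs_sub_abs_le_abs_sub S' (singularSeries H2); rw [abs_sub_comm] at this; linarith
    have h2 : C𝔖 / x ≤ C𝔖 := div_le_self hC𝔖0 hx1.le
    rw [hS𝔖]; linarith
  -- KB1
  obtain ⟨A₁, hA₁⟩ : ∃ A₁ : ℝ, A₁ = 972 ^ (shiftDiff h₁ h₂).primeFactors.card *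
      Real.exp (26 * (Real.log (Real.log ((x + 1 : ℕ) : ℝ)) + 4)) := ⟨_, rfl⟩
  have hA₁0 : 0 ≤ A₁ := by rw [hA₁]; positivity
  have hKB1' : ∀ τ : Slot → ℝ, ‖assemblyKernel χ h₁ h₂ η x A τ‖ ≤ A₁ := fun τ => by
    rw [hA₁]; exact kernel_KB1 χ hX0 hR1 hne hA1 (by omega : 2 ≤ x + 1) τ
  -- KB2, KB3 at `κ = max κ₂ κ₃`
  obtain ⟨A₂, hA₂⟩ : ∃ A₂ : ℝ, A₂ = C₂ * Real.log η ^ c₂ := ⟨_, rfl⟩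
  obtain ⟨A₃, hA₃⟩ : ∃ A₃ : ℝ, A₃ = C₃ * Real.log η ^ (-(1 : ℝ) / 14) := ⟨_, rfl⟩
  have hA₂0 : 0 ≤ A₂ := by rw [hA₂]; positivity
  have hA₃0 : 0 ≤ A₃ := by
    rw [hA₃]; have := Real.rpow_nonneg (by linarith : 0 ≤ Real.log η) (-(1 : ℝ) / 14); positivity
  have hKB2' : ∀ τ : Slot → ℝ, (∀ k, |τ k| ≤ boxThr X (X ^ ((1 : ℝ) / 20)) k) →
      ‖assemblyKernel χ h₁ h₂ η x A τ‖ ≤ A₂ * (X ^ 2)⁻¹ * polyWeight X κ τ := fun τ hτ =>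
    (hK2 q χ η hS hη₂ x hx41 hxhi A hA1 τ hτ).trans (by
      rw [hA₂]; exact mul_le_mul_of_nonneg_left (polyWeight_mono hX0.le (le_max_left _ _) τ) (by positivity))
  have hKB3' : ∀ τ : Slot → ℝ, (∀ k, |τ k| ≤ boxThr X (Real.log η ^ ((1 : ℝ) / 200)) k) →
      ‖assemblyKernel χ h₁ h₂ η x A τ - (S' : ℂ) * ∏ j : Fin 2, eulerTrunc (x + 1) (zetaSlotS X (τ (j, 0)))‖ ≤
        A₃ * (X ^ 2)⁻¹ * polyWeight X κ τ := fun τ hτ =>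
    (hK3 q χ η hS hη₃ x hx41 hxhi A hA1 τ hτ).trans (by
      rw [hA₃]; exact mul_le_mul_of_nonneg_left (polyWeight_mono hX0.le (le_max_right _ _) τ) (by positivity))
  have hT0 : 0 ≤ X ^ ((1 : ℝ) / 20) := Real.rpow_nonneg hX0.le _
  have hT'0 : 0 ≤ Real.log η ^ ((1 : ℝ) / 200) := Real.rpow_nonneg (by linarith) _
  have hmain := abs_sharpCorr_sub_le_of_kernelBounds χ hχq hφ hψ hB₀ hB₁ hBψ hM hCs hU2 hU22 hU3 hR1 hne
    (pp_x₁_le (ε₀ := ε₀) hxnat1) hxX₁ hxX₂ (show (0 : ℝ) < 1 / 4 by norm_num) (pp_lo hxnat1 hq3 hε₀ hε₀20)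
    (pp_hi hxnat1 hh₁x hU2) (pp_hi hxnat1 hh₂x hU2) (pp_Dmax (ε₀ := ε₀) (q := q) (x := x) hh₁H)
    (pp_Dmax (ε₀ := ε₀) (q := q) (x := x) hh₂H) hA1 hAD hNmax hNX hC₀1 hζ₀ hτ₀ hsmall (show 3 ≤ 30 by norm_num)
    hL0 hLD hLx₁ hLx₂ hχE (nd := nd) (le_trans hκ₂ (le_max_left _ _)) hT0 hT'0 hA₁0 hA₂0 hA₃0 (S' := S') hKB1' hKB2' hKB3'
  /- ───── abbreviations for the pieces ───── -/
  set Lη : ℝ := Real.log η ^ ((1 : ℝ) / 20) with hLηdef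
  have hLηpos : 0 < Lη := Real.rpow_pos_of_pos (by linarith) _
  have hlogx1 : 1 ≤ 1 + Real.log x := by linarith
  have hX1X : X ≤ 1 + X := by linarith
  -- sizes of the coefficient constants
  have hCc := sharpCoeffBound_le (Bψ := Bψ) (U₀ := U₀) hB₀0 hX1 hUhi
  have hKΨ := psiAbelConst_le hB₀0 hB₁0 hBψ0 hX1
  -- the triple sums and counts
  have hBreal : (Bmax : ℝ) ≤ Real.exp 1 * (x : ℝ) ^ (ε₀ / 20) * (q : ℝ) ^ 2 := ppBmax_le ε₀ (by omega : 1 ≤ q) hxnat1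
  have hBD : Real.exp 1 * (x : ℝ) ^ (ε₀ / 20) * (q : ℝ) ^ 2 ≤ 4 * Real.exp 1 * (x : ℝ) ^ (ε₀ / 10) * (q : ℝ) ^ 4 := by
    have hq1 : (1 : ℝ) ≤ q := by exact_mod_cast (by omega : 1 ≤ q)
    have h1 : (x : ℝ) ^ (ε₀ / 20) ≤ (x : ℝ) ^ (ε₀ / 10) := Real.rpow_le_rpow_of_exponent_le hx1.le (by linarith)
    have h2 : (q : ℝ) ^ 2 ≤ (q : ℝ) ^ 4 := pow_le_pow_right₀ hq1 (by norm_num)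
    have h3 : Real.exp 1 ≤ 4 * Real.exp 1 := by have := Real.exp_pos 1; linarith
    have : 0 ≤ (x : ℝ) ^ (ε₀ / 20) := by positivity
    calc Real.exp 1 * (x : ℝ) ^ (ε₀ / 20) * (q : ℝ) ^ 2 ≤ (4 * Real.exp 1) * (x : ℝ) ^ (ε₀ / 10) * (q : ℝ) ^ 4 := by
          gcongr
      _ = _ := by ring
  have hBx : Bmax ≤ x := by exact_mod_cast (hBreal.trans (hBD.trans hDx'))
  have hx2 : x ≤ x ^ 2 := Nat.le_self_pow two_ne_zero x
  obtain hSB := tripleGcdSum_le_of_le (q := q) (by omega) hR0 hxnat1 hRx (hBx.trans hx2)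
  obtain hSD := tripleGcdSum_le_of_le (q := q) (by omega) hR0 hxnat1 hRx (hDx.trans hx2)
  have hτq : ((#(q.divisors) : ℕ) : ℝ) ≤ Cτ * (q : ℝ) ^ ((1 : ℝ) / 64) := hCτ q (by omega)
  set Smax : ℝ := ((#q.divisors : ℕ) : ℝ) ^ 4 * (5 + 4 * Real.log x) ^ 8 with hSmax
  set Nmax : ℝ := 4 * Real.exp 1 * (x : ℝ) ^ (ε₀ / 10) * (q : ℝ) ^ 4 * R ^ 2 with hNmax
  have hNB : (#(sharpTriples R Bmax) : ℝ) ≤ Nmax :=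
    (card_sharpTriples_le hR0 Bmax).trans (by rw [hNmax]; exact mul_le_mul_of_nonneg_right (hBreal.trans hBD) (sq_nonneg _))
  have hND : (#(sharpTriples R Dmax) : ℝ) ≤ Nmax :=
    (card_sharpTriples_le hR0 Dmax).trans (by rw [hNmax]; exact mul_le_mul_of_nonneg_right hDreal (sq_nonneg _))
  /- ───── exponent bookkeeping: `q^{9/8} x^{ε₀/5} q⁸ R⁴ ≤ x^{1/2}` ───── -/
  have hq1 : (1 : ℝ) ≤ q := by exact_mod_cast (by omega : 1 ≤ q)
  have hxpow : ∀ a b : ℝ, a ≤ b → (x : ℝ) ^ a ≤ (x : ℝ) ^ b := fun a b hab => Real.rpow_le_rpow_of_exponent_le hx1.le hab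
  have hxmul : ∀ a b : ℝ, (x : ℝ) ^ a * (x : ℝ) ^ b = (x : ℝ) ^ (a + b) := fun a b => (Real.rpow_add hx0 a b).symm
  have hR4 : R ^ 4 ≤ (x : ℝ) ^ ((1 : ℝ) / 25) := by
    calc R ^ 4 ≤ ((x : ℝ) ^ c') ^ 4 := pow_le_pow_left₀ hR0 hRc' 4
      _ = (x : ℝ) ^ (c' * 4) := by rw [← Real.rpow_natCast _ 4, ← Real.rpow_mul hx0.le]; norm_num
      _ ≤ (x : ℝ) ^ ((1 : ℝ) / 25) := hxpow _ _ (by linarith only [hc'1])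
  have hq738 : (q : ℝ) ^ ((9 : ℝ) / 8) * (q : ℝ) ^ 8 ≤ (x : ℝ) ^ ((73 : ℝ) / 160) := by
    have h1 : (q : ℝ) ^ ((9 : ℝ) / 8) * (q : ℝ) ^ 8 = (q : ℝ) ^ ((73 : ℝ) / 8) := by
      rw [← Real.rpow_natCast _ 8, ← Real.rpow_add hq0]; norm_num
    rw [h1]
    calc (q : ℝ) ^ ((73 : ℝ) / 8) ≤ ((x : ℝ) ^ ((1 : ℝ) / 20)) ^ ((73 : ℝ) / 8) := Real.rpow_le_rpow hq0.le hqx20 (by norm_num)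
      _ = (x : ℝ) ^ ((73 : ℝ) / 160) := by rw [← Real.rpow_mul hx0.le]; norm_num
  have hxε5 : (x : ℝ) ^ (ε₀ / 5) ≤ (x : ℝ) ^ ((1 : ℝ) / 500) := hxpow _ _ (by linarith only [hε₀1])
  have hbig : (q : ℝ) ^ ((9 : ℝ) / 8) * ((x : ℝ) ^ (ε₀ / 5) * (q : ℝ) ^ 8 * R ^ 4) ≤ (x : ℝ) ^ ((1 : ℝ) / 2) := by
    calc (q : ℝ) ^ ((9 : ℝ) / 8) * ((x : ℝ) ^ (ε₀ / 5) * (q : ℝ) ^ 8 * R ^ 4)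
        = ((q : ℝ) ^ ((9 : ℝ) / 8) * (q : ℝ) ^ 8) * (x : ℝ) ^ (ε₀ / 5) * R ^ 4 := by ring
      _ ≤ (x : ℝ) ^ ((73 : ℝ) / 160) * (x : ℝ) ^ ((1 : ℝ) / 500) * (x : ℝ) ^ ((1 : ℝ) / 25) := by
          gcongr
      _ = (x : ℝ) ^ ((73 : ℝ) / 160 + (1 : ℝ) / 500 + (1 : ℝ) / 25) := by rw [hxmul, hxmul]
      _ ≤ (x : ℝ) ^ ((1 : ℝ) / 2) := hxpow _ _ (by norm_num)
  have hq98 : (1 : ℝ) ≤ (q : ℝ) ^ ((9 : ℝ) / 8) := Real.one_le_rpow hq1 (by norm_num)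
  have hsmallpow : (x : ℝ) ^ (ε₀ / 5) * (q : ℝ) ^ 8 * R ^ 4 ≤ (x : ℝ) ^ ((1 : ℝ) / 2) := by
    have h0 : 0 ≤ (x : ℝ) ^ (ε₀ / 5) * (q : ℝ) ^ 8 * R ^ 4 := by positivity
    calc (x : ℝ) ^ (ε₀ / 5) * (q : ℝ) ^ 8 * R ^ 4 = 1 * ((x : ℝ) ^ (ε₀ / 5) * (q : ℝ) ^ 8 * R ^ 4) := (one_mul _).symm
      _ ≤ (q : ℝ) ^ ((9 : ℝ) / 8) * ((x : ℝ) ^ (ε₀ / 5) * (q : ℝ) ^ 8 * R ^ 4) := mul_le_mul_of_nonneg_right hq98 h0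
      _ ≤ _ := hbig
  -- `Nmax² = 16e² x^{ε₀/5} q⁸ R⁴`
  have hNmax2 : Nmax ^ 2 = (4 * Real.exp 1) ^ 2 * ((x : ℝ) ^ (ε₀ / 5) * (q : ℝ) ^ 8 * R ^ 4) := by
    rw [hNmax]
    have : ((x : ℝ) ^ (ε₀ / 10)) ^ 2 = (x : ℝ) ^ (ε₀ / 5) := by rw [← Real.rpow_natCast _ 2, ← Real.rpow_mul hx0.le]; ring_nf
    calc (4 * Real.exp 1 * (x : ℝ) ^ (ε₀ / 10) * (q : ℝ) ^ 4 * R ^ 2) ^ 2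
        = (4 * Real.exp 1) ^ 2 * (((x : ℝ) ^ (ε₀ / 10)) ^ 2 * ((q : ℝ) ^ 4) ^ 2 * (R ^ 2) ^ 2) := by ring
      _ = _ := by rw [this]; ring
  -- `x^{1/2} = x · x^{-1/2}`
  have hxhalf : (x : ℝ) ^ ((1 : ℝ) / 2) = x * (x : ℝ) ^ (-((1 : ℝ) / 2)) := by
    calc (x : ℝ) ^ ((1 : ℝ) / 2) = (x : ℝ) ^ ((1 : ℝ) + (-((1 : ℝ) / 2))) := by norm_num
      _ = (x : ℝ) ^ (1 : ℝ) * (x : ℝ) ^ (-((1 : ℝ) / 2)) := Real.rpow_add hx0 _ _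
      _ = _ := by rw [Real.rpow_one]
  /- ───── absorbed pieces ───── -/
  have habs_a := hKa q χ η hS x hx41
  have habs_b := hKb' q χ η hS x hx1.le hxhi
  have habs_c := hKc q χ η hS x hx41
  have habs_d := hKd q χ η hS x hx41
  have habs_e := hKe q χ η hS x hx41
  have habs_f := hKf q χ η hS x hx41
  simp only [pow_zero, one_mul] at habs_a habs_e
  /- ───── P1: the χ-twisted error ───── -/
  set cC : ℝ := B₀ * (6 + Bψ) with hcC
  set cK : ℝ := 9 * Bψ * (B₀ + 17 * B₁) with hcK
  set Kq : ℝ := (q : ℝ) ^ ((1 : ℝ) / 2 + 1 / 8) with hKq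
  have hKq : Kq = (q : ℝ) ^ ((5 : ℝ) / 8) := by rw [hKq]; norm_num
  have hK37b : Kb ≤ K37 * Kq := by rw [hKb]; refine mul_le_mul_of_nonneg_right ?_ (by positivity); rw [hK37]; linarith only [hCl0, hCr0]
  have hK37l : Kl ≤ K37 * Kq := by rw [hKl]; refine mul_le_mul_of_nonneg_right ?_ (by positivity); rw [hK37]; linarith only [hCb0, hCr0]
  have hK37r : Kr ≤ K37 * Kq := by rw [hKr]; refine mul_le_mul_of_nonneg_right ?_ (by positivity); rw [hK37]; linarith only [hCb0, hCl0]
  have hSmax0 : 0 ≤ Smax := by rw [hSmax]; have := Real.log_nonneg hx1.le; positivity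
  have hEχ := typeI_error_le (Bψ := Bψ) (xq := (x : ℝ) / q) (sq := Real.sqrt q)
    (by have := hCc; unfold sharpCoeffBound; positivity) (by unfold psiAbelConst; positivity) hKb0 hKl0 hKr0
    (tripleGcdSum_nonneg _ _) (tripleGcdSum_nonneg _ _) (Nat.cast_nonneg _) (Nat.cast_nonneg _) (by positivity) (Real.sqrt_nonneg _)
    hCc hKΨ hK37b hK37l hK37r hSB hSD hNB hND
  -- `Kq · (x/q) · Smax² ≤ x · Cτ⁸ 9^{16} (1+X)^{16} q^{-1/4}` and `Kq √q Nmax² ≤ 16e² x x^{-1/2}`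
  have hτ8 : ((#q.divisors : ℕ) : ℝ) ^ 8 ≤ Cτ ^ 8 * (q : ℝ) ^ ((1 : ℝ) / 8) := by
    calc ((#q.divisors : ℕ) : ℝ) ^ 8 ≤ (Cτ * (q : ℝ) ^ ((1 : ℝ) / 64)) ^ 8 := pow_le_pow_left₀ (Nat.cast_nonneg _) hτq 8
      _ = Cτ ^ 8 * (q : ℝ) ^ ((1 : ℝ) / 8) := by rw [mul_pow, ← Real.rpow_natCast ((q : ℝ) ^ _) 8, ← Real.rpow_mul hq0.le]; norm_num
  have h54 : (5 + 4 * Real.log x) ^ 16 ≤ 9 ^ 16 * (1 + X) ^ 16 := by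
    have h := five_add_four_log_pow_le hx1.le
    have h0 : 0 ≤ (5 + 4 * Real.log x) ^ 8 := by positivity
    calc (5 + 4 * Real.log x) ^ 16 = (5 + 4 * Real.log x) ^ 8 * (5 + 4 * Real.log x) ^ 8 := by ring
      _ ≤ (9 ^ 8 * (1 + Real.log x) ^ 8) * (9 ^ 8 * (1 + Real.log x) ^ 8) := mul_le_mul h h h0 (by positivity)
      _ = 9 ^ 16 * (1 + X) ^ 16 := by rw [hXdef]; ring
  have hP1a : Kq * ((x : ℝ) / q * Smax ^ 2) ≤ x * (Cτ ^ 8 * 9 ^ 16 * ((1 + X) ^ 16 * (q : ℝ) ^ (-((1 : ℝ) / 4)))) := by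
    have hS2 : Smax ^ 2 = ((#q.divisors : ℕ) : ℝ) ^ 8 * (5 + 4 * Real.log x) ^ 16 := by rw [hSmax]; ring
    have hqpow : Kq * (1 / (q : ℝ)) * (q : ℝ) ^ ((1 : ℝ) / 8) = (q : ℝ) ^ (-((1 : ℝ) / 4)) := by
      rw [hKq, one_div, ← Real.rpow_neg_one, ← Real.rpow_add hq0, ← Real.rpow_add hq0]; norm_num
    calc Kq * ((x : ℝ) / q * Smax ^ 2) = x * ((Kq * (1 / (q : ℝ))) * (((#q.divisors : ℕ) : ℝ) ^ 8 * (5 + 4 * Real.log x) ^ 16)) := by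
          rw [hS2]; ring
      _ ≤ x * ((Kq * (1 / (q : ℝ))) * ((Cτ ^ 8 * (q : ℝ) ^ ((1 : ℝ) / 8)) * (9 ^ 16 * (1 + X) ^ 16))) := by
          refine mul_le_mul_of_nonneg_left (mul_le_mul_of_nonneg_left (mul_le_mul hτ8 h54 (by positivity) (by positivity)) (by positivity)) hx0.le
      _ = x * (Cτ ^ 8 * 9 ^ 16 * ((1 + X) ^ 16 * (Kq * (1 / (q : ℝ)) * (q : ℝ) ^ ((1 : ℝ) / 8)))) := by ring
      _ = _ := by rw [hqpow]
  have hP1b : Kq * (Real.sqrt q * Nmax ^ 2) ≤ x * ((4 * Real.exp 1) ^ 2 * (x : ℝ) ^ (-((1 : ℝ) / 2))) := by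
    have hsq : Kq * Real.sqrt q = (q : ℝ) ^ ((9 : ℝ) / 8) := by
      rw [hKq, Real.sqrt_eq_rpow, ← Real.rpow_add hq0]; norm_num
    calc Kq * (Real.sqrt q * Nmax ^ 2) = (4 * Real.exp 1) ^ 2 * ((Kq * Real.sqrt q) * ((x : ℝ) ^ (ε₀ / 5) * (q : ℝ) ^ 8 * R ^ 4)) := by
          rw [hNmax2]; ring
      _ ≤ (4 * Real.exp 1) ^ 2 * (x : ℝ) ^ ((1 : ℝ) / 2) := by rw [hsq]; exact mul_le_mul_of_nonneg_left hbig (by positivity)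
      _ = _ := by rw [hxhalf]; ring
  have hX16 : (1 + X) ^ 16 ≤ (1 + X) ^ 20 := pow_le_pow_right₀ (by linarith only [hX1]) (by norm_num)
  have hX4 : X ^ 4 ≤ (1 + X) ^ 4 := pow_le_pow_left₀ hX0.le hX1X 4
  have hX420 : X ^ 4 * (1 + X) ^ 16 ≤ (1 + X) ^ 20 := by
    calc X ^ 4 * (1 + X) ^ 16 ≤ (1 + X) ^ 4 * (1 + X) ^ 16 := mul_le_mul_of_nonneg_right hX4 (by positivity)
      _ = (1 + X) ^ 20 := by ring
  have hX4' : X ^ 4 ≤ (1 + X) ^ 20 := hX4.trans (pow_le_pow_right₀ (by linarith only [hX1]) (by norm_num))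
  have hEχx : (cC * X ^ 2) ^ 2 + 2 * (cC * X ^ 2) * (cK * X ^ 2) = X ^ 4 * (cC ^ 2 + 2 * cC * cK) := by ring
  -- the absorbed form of `E_χ`
  have hP1 : ((B₀ * (6 + Bψ) * X ^ 2) ^ 2 + 2 * (B₀ * (6 + Bψ) * X ^ 2) * (9 * Bψ * (B₀ + 17 * B₁) * X ^ 2)) * Bψ ^ 4 * (K37 * Kq) *
      ((x : ℝ) / q * Smax ^ 2 + Real.sqrt q * Nmax ^ 2) ≤ x * (Kχ * (Kb' / Lη + Kc / Lη)) := by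
    have hcc0 : 0 ≤ cC ^ 2 + 2 * cC * cK := by positivity
    have hK370 : 0 ≤ K37 := by rw [hK37]; positivity
    have hstep : (K37 * Kq) * ((x : ℝ) / q * Smax ^ 2 + Real.sqrt q * Nmax ^ 2) ≤
        K37 * (x * (Cτ ^ 8 * 9 ^ 16 * ((1 + X) ^ 16 * (q : ℝ) ^ (-((1 : ℝ) / 4)))) + x * ((4 * Real.exp 1) ^ 2 * (x : ℝ) ^ (-((1 : ℝ) / 2)))) := by
      rw [show (K37 * Kq) * ((x : ℝ) / q * Smax ^ 2 + Real.sqrt q * Nmax ^ 2) =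
        K37 * (Kq * ((x : ℝ) / q * Smax ^ 2) + Kq * (Real.sqrt q * Nmax ^ 2)) by ring]
      exact mul_le_mul_of_nonneg_left (add_le_add hP1a hP1b) hK370
    have habs1 : (1 + X) ^ 20 * (q : ℝ) ^ (-((1 : ℝ) / 4)) ≤ Kb' / Lη := by rw [hXdef]; exact habs_b
    have habs2 : (1 + X) ^ 20 * (x : ℝ) ^ (-((1 : ℝ) / 2)) ≤ Kc / Lη := by rw [hXdef]; exact habs_c
    have hq4pos : 0 ≤ (q : ℝ) ^ (-((1 : ℝ) / 4)) := Real.rpow_nonneg hq0.le _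
    have hx2pos : 0 ≤ (x : ℝ) ^ (-((1 : ℝ) / 2)) := Real.rpow_nonneg hx0.le _
    calc _ = (cC ^ 2 + 2 * cC * cK) * Bψ ^ 4 * (X ^ 4 * ((K37 * Kq) * ((x : ℝ) / q * Smax ^ 2 + Real.sqrt q * Nmax ^ 2))) := by
          rw [← hcC, ← hcK, hEχx]; ring
      _ ≤ (cC ^ 2 + 2 * cC * cK) * Bψ ^ 4 * (X ^ 4 * (K37 * (x * (Cτ ^ 8 * 9 ^ 16 * ((1 + X) ^ 16 * (q : ℝ) ^ (-((1 : ℝ) / 4)))) +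
            x * ((4 * Real.exp 1) ^ 2 * (x : ℝ) ^ (-((1 : ℝ) / 2)))))) := by
          refine mul_le_mul_of_nonneg_left (mul_le_mul_of_nonneg_left hstep (by positivity)) (by positivity)
      _ = x * ((cC ^ 2 + 2 * cC * cK) * Bψ ^ 4 * K37 * (Cτ ^ 8 * 9 ^ 16 * ((X ^ 4 * (1 + X) ^ 16) * (q : ℝ) ^ (-((1 : ℝ) / 4))) +
            (4 * Real.exp 1) ^ 2 * (X ^ 4 * (x : ℝ) ^ (-((1 : ℝ) / 2))))) := by ring
      _ ≤ x * ((cC ^ 2 + 2 * cC * cK) * Bψ ^ 4 * K37 * (Cτ ^ 8 * 9 ^ 16 * ((1 + X) ^ 20 * (q : ℝ) ^ (-((1 : ℝ) / 4))) +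
            (4 * Real.exp 1) ^ 2 * ((1 + X) ^ 20 * (x : ℝ) ^ (-((1 : ℝ) / 2))))) := by
          gcongr
      _ ≤ x * ((cC ^ 2 + 2 * cC * cK) * Bψ ^ 4 * K37 * (Cτ ^ 8 * 9 ^ 16 * (Kb' / Lη) + (4 * Real.exp 1) ^ 2 * (Kc / Lη))) := by
          gcongr
      _ ≤ x * (Kχ * (Kb' / Lη + Kc / Lη)) := by
          refine mul_le_mul_of_nonneg_left ?_ hx0.le
          rw [hKχ]
          have h1 : 0 ≤ Kb' / Lη := by positivity
          have h2 : 0 ≤ Kc / Lη := by positivity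
          have h3 : 0 ≤ (cC ^ 2 + 2 * cC * cK) * Bψ ^ 4 * K37 := by positivity
          have h4 : Cτ ^ 8 * 9 ^ 16 * (Kb' / Lη) + (4 * Real.exp 1) ^ 2 * (Kc / Lη) ≤
              (Cτ ^ 8 * (9 ^ 8) ^ 2 + (4 * Real.exp 1) ^ 2) * (Kb' / Lη + Kc / Lη) := by
            nlinarith only [h1, h2, sq_nonneg (Cτ ^ 4), sq_nonneg (4 * Real.exp 1), show (9:ℝ) ^ 16 = (9 ^ 8) ^ 2 by norm_num]
          calc (cC ^ 2 + 2 * cC * cK) * Bψ ^ 4 * K37 * (Cτ ^ 8 * 9 ^ 16 * (Kb' / Lη) + (4 * Real.exp 1) ^ 2 * (Kc / Lη))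
              ≤ (cC ^ 2 + 2 * cC * cK) * Bψ ^ 4 * K37 * ((Cτ ^ 8 * (9 ^ 8) ^ 2 + (4 * Real.exp 1) ^ 2) * (Kb' / Lη + Kc / Lη)) :=
                mul_le_mul_of_nonneg_left h4 h3
            _ = _ := by ring
  /- ───── P2: the CRT/summation-by-parts error ───── -/
  have hP2 : Bψ ^ 4 * psiAbelConst B₀ B₁ Bψ X ^ 2 * (#(sharpTriples R Dmax) : ℝ) ^ 2 ≤ x * (Kcrt * (Kc / Lη)) := by
    have hK0 : 0 ≤ psiAbelConst B₀ B₁ Bψ X := by unfold psiAbelConst; positivity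
    have habs2 : (1 + X) ^ 20 * (x : ℝ) ^ (-((1 : ℝ) / 2)) ≤ Kc / Lη := by rw [hXdef]; exact habs_c
    calc Bψ ^ 4 * psiAbelConst B₀ B₁ Bψ X ^ 2 * (#(sharpTriples R Dmax) : ℝ) ^ 2
        ≤ Bψ ^ 4 * (cK * X ^ 2) ^ 2 * Nmax ^ 2 := by gcongr
      _ = Bψ ^ 4 * cK ^ 2 * (4 * Real.exp 1) ^ 2 * (X ^ 4 * ((x : ℝ) ^ (ε₀ / 5) * (q : ℝ) ^ 8 * R ^ 4)) := by rw [hNmax2]; ring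
      _ ≤ Bψ ^ 4 * cK ^ 2 * (4 * Real.exp 1) ^ 2 * (X ^ 4 * (x : ℝ) ^ ((1 : ℝ) / 2)) := by gcongr
      _ = x * (Kcrt * (X ^ 4 * (x : ℝ) ^ (-((1 : ℝ) / 2)))) := by rw [hKcrt, hxhalf]; ring
      _ ≤ x * (Kcrt * ((1 + X) ^ 20 * (x : ℝ) ^ (-((1 : ℝ) / 2)))) := by gcongr
      _ ≤ x * (Kcrt * (Kc / Lη)) := by gcongr
  /- ───── P3: the kernel error level ───── -/
  have hke := kernelEps_le (M := M) (Cs := Cs) (κ := κ) (nd := nd) hM0 hCs0 hX1 hε₀ (by linarith only [hε₀1]) hUlo hUhi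
    hT0 hT'0 hA₁0 hA₂0 hA₃0 S'
  have hcP0 : 0 ≤ prodIConst M Cs ε₀ κ := prodIConst_nonneg M Cs ε₀ κ
  have hcT0 : 0 ≤ tailConst M Cs ε₀ κ nd := tailConst_nonneg hM0 hCs0 hε₀ κ nd
  have hlogη0 : 0 ≤ Real.log η := by linarith only [hLη]
  -- the tails
  have htail : ∀ (Tv : ℝ) (e : ℝ), 0 < Tv → ((1 + ε₀ * Tv / (40 * π)) ^ nd)⁻¹ ≤ (40 * π / ε₀) ^ nd * (Tv ^ nd)⁻¹ := by
    intro Tv e hTv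
    have h1 : ε₀ / (40 * π) * Tv ≤ 1 + ε₀ * Tv / (40 * π) := by
      have : ε₀ / (40 * π) * Tv = ε₀ * Tv / (40 * π) := by ring
      rw [this]; linarith only [show (0:ℝ) ≤ 0 from le_rfl]
    have h2 : 0 < ε₀ / (40 * π) * Tv := by positivity
    calc ((1 + ε₀ * Tv / (40 * π)) ^ nd)⁻¹ ≤ ((ε₀ / (40 * π) * Tv) ^ nd)⁻¹ :=
          inv_anti₀ (pow_pos h2 nd) (pow_le_pow_left₀ h2.le h1 nd)
      _ = (40 * π / ε₀) ^ nd * (Tv ^ nd)⁻¹ := by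
          rw [mul_pow, mul_inv, ← inv_pow, inv_div]
  have hT'pos : 0 < Real.log η ^ ((1 : ℝ) / 200) := Real.rpow_pos_of_pos (by linarith only [hLη]) _
  have hTpos : 0 < X ^ ((1 : ℝ) / 20) := Real.rpow_pos_of_pos hX0 _
  have hθ' : ((1 + ε₀ * Real.log η ^ ((1 : ℝ) / 200) / (40 * π)) ^ nd)⁻¹ ≤
      (40 * π / ε₀) ^ nd * Real.log η ^ (-((nd : ℝ) / 200)) := by
    refine (htail _ 0 hT'pos).trans (le_of_eq ?_)
    congr 1
    rw [← Real.rpow_natCast (Real.log η ^ ((1 : ℝ) / 200)) nd, ← Real.rpow_mul hlogη0, ← Real.rpow_neg hlogη0]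
    congr 1; ring
  have hθ : ((1 + ε₀ * X ^ ((1 : ℝ) / 20) / (40 * π)) ^ nd)⁻¹ ≤ (40 * π / ε₀) ^ nd * X ^ (-((nd : ℝ) / 20)) := by
    refine (htail _ 0 hTpos).trans (le_of_eq ?_)
    congr 1
    rw [← Real.rpow_natCast (X ^ ((1 : ℝ) / 20)) nd, ← Real.rpow_mul hX0.le, ← Real.rpow_neg hX0.le]
    congr 1; ring
  -- (i) the `A₃` term
  have hP3a : A₃ * prodIConst M Cs ε₀ κ ≤ Kker₃ / Lη := by
    rw [hA₃, hKker₃, show C₃ * Real.log η ^ (-(1 : ℝ) / 14) * prodIConst M Cs ε₀ κ =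
      (C₃ * prodIConst M Cs ε₀ κ) * Real.log η ^ (-((1 : ℝ) / 14)) by ring_nf]
    exact log_eta_rpow_neg_le hS (by norm_num) (by positivity)
  -- (ii) the `A₂ + |S'|A₄` term
  have hP3b : (A₂ + |S'| * modelA₄) * tailConst M Cs ε₀ κ nd * ((1 + ε₀ * Real.log η ^ ((1 : ℝ) / 200) / (40 * π)) ^ nd)⁻¹ ≤
      Kker₂ / Lη := by
    have hA4 := modelA₄_nonneg
    have h1 : (A₂ + |S'| * modelA₄) * Real.log η ^ (-((nd : ℝ) / 200)) ≤ (C₂ + S𝔖 * modelA₄) / Lη := by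
      have hc₂ : C₂ * Real.log η ^ c₂ * Real.log η ^ (-((nd : ℝ) / 200)) ≤ C₂ / Lη := by
        rw [mul_assoc, ← Real.rpow_add (by linarith only [hLη]), show c₂ + -((nd : ℝ) / 200) = -((nd : ℝ) / 200 - c₂) by ring]
        exact log_eta_rpow_neg_le hS (by linarith only [hnd1]) hC₂0
      have hs : |S'| * modelA₄ * Real.log η ^ (-((nd : ℝ) / 200)) ≤ S𝔖 * modelA₄ / Lη := by
        calc |S'| * modelA₄ * Real.log η ^ (-((nd : ℝ) / 200)) ≤ S𝔖 * modelA₄ * Real.log η ^ (-((nd : ℝ) / 200)) := by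
              gcongr
          _ ≤ S𝔖 * modelA₄ / Lη := log_eta_rpow_neg_le hS (by
              have : (1 : ℝ) / 20 ≤ (nd : ℝ) / 200 - c₂ := by linarith only [hnd1]
              linarith only [this, hc₂0]) (by
              have : 0 ≤ S𝔖 := (abs_nonneg _).trans hS'le
              positivity)
      rw [hA₂, add_mul, add_div]
      exact add_le_add hc₂ hs
    calc (A₂ + |S'| * modelA₄) * tailConst M Cs ε₀ κ nd * ((1 + ε₀ * Real.log η ^ ((1 : ℝ) / 200) / (40 * π)) ^ nd)⁻¹
        ≤ (A₂ + |S'| * modelA₄) * tailConst M Cs ε₀ κ nd * ((40 * π / ε₀) ^ nd * Real.log η ^ (-((nd : ℝ) / 200))) :=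
          mul_le_mul_of_nonneg_left hθ' (by positivity)
      _ = tailConst M Cs ε₀ κ nd * (40 * π / ε₀) ^ nd * ((A₂ + |S'| * modelA₄) * Real.log η ^ (-((nd : ℝ) / 200))) := by ring
      _ ≤ tailConst M Cs ε₀ κ nd * (40 * π / ε₀) ^ nd * ((C₂ + S𝔖 * modelA₄) / Lη) :=
          mul_le_mul_of_nonneg_left h1 (by positivity)
      _ = Kker₂ / Lη := by rw [hKker₂]; ring
  -- (iii) the `A₁` term
  have hlogx1' : Real.log ((x + 1 : ℕ) : ℝ) ≤ 2 * X := by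
    have := pp_log_add_le (x := x) (h := 1) hxnat1 hxnat1
    linarith only [this, hX1]
  have hlogx1pos : 0 < Real.log ((x + 1 : ℕ) : ℝ) := Real.log_pos (by push_cast; linarith only [hx1])
  have hA₁le : A₁ ≤ A₁c * X ^ 26 := by
    rw [hA₁, hA₁c]
    have hexp : Real.exp (26 * (Real.log (Real.log ((x + 1 : ℕ) : ℝ)) + 4)) = Real.exp (26 * 4) * Real.log ((x + 1 : ℕ) : ℝ) ^ 26 := by
      rw [mul_add, Real.exp_add, mul_comm (Real.exp (26 * 4)), show (26 : ℝ) * Real.log (Real.log ((x + 1 : ℕ) : ℝ)) =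
        ((26 : ℕ) : ℝ) * Real.log (Real.log ((x + 1 : ℕ) : ℝ)) by norm_num, Real.exp_nat_mul, Real.exp_log hlogx1pos]
    rw [hexp]
    have h26 : Real.log ((x + 1 : ℕ) : ℝ) ^ 26 ≤ (2 * X) ^ 26 := pow_le_pow_left₀ hlogx1pos.le hlogx1' 26
    calc 972 ^ (shiftDiff h₁ h₂).primeFactors.card * (Real.exp (26 * 4) * Real.log ((x + 1 : ℕ) : ℝ) ^ 26)
        ≤ 972 ^ (shiftDiff h₁ h₂).primeFactors.card * (Real.exp (26 * 4) * (2 * X) ^ 26) := by gcongr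
      _ = 972 ^ (shiftDiff h₁ h₂).primeFactors.card * Real.exp (26 * 4) * 2 ^ 26 * X ^ 26 := by ring
  have hXexp : X ^ 2 * X ^ 26 * X ^ (-((nd : ℝ) / 20)) ≤ X ^ (-(7 : ℝ) / 10) := by
    rw [← Real.rpow_natCast X 2, ← Real.rpow_natCast X 26, ← Real.rpow_add hX0, ← Real.rpow_add hX0]
    refine Real.rpow_le_rpow_of_exponent_le hX1 ?_
    push_cast; linarith only [hnd2]
  have hP3c : A₁ * tailConst M Cs ε₀ κ nd * X ^ 2 * ((1 + ε₀ * X ^ ((1 : ℝ) / 20) / (40 * π)) ^ nd)⁻¹ ≤ Kker₁ * (Kf / Lη) := by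
    have hA₁c0 : 0 ≤ A₁c := by rw [hA₁c]; positivity
    have habsf : X ^ (-(7 : ℝ) / 10) ≤ Kf / Lη := by rw [hXdef]; exact habs_f
    calc A₁ * tailConst M Cs ε₀ κ nd * X ^ 2 * ((1 + ε₀ * X ^ ((1 : ℝ) / 20) / (40 * π)) ^ nd)⁻¹
        ≤ (A₁c * X ^ 26) * tailConst M Cs ε₀ κ nd * X ^ 2 * ((40 * π / ε₀) ^ nd * X ^ (-((nd : ℝ) / 20))) := by gcongr
      _ = A₁c * tailConst M Cs ε₀ κ nd * (40 * π / ε₀) ^ nd * (X ^ 2 * X ^ 26 * X ^ (-((nd : ℝ) / 20))) := by ring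
      _ ≤ A₁c * tailConst M Cs ε₀ κ nd * (40 * π / ε₀) ^ nd * X ^ (-(7 : ℝ) / 10) :=
          mul_le_mul_of_nonneg_left hXexp (by positivity)
      _ ≤ Kker₁ * X ^ (-(7 : ℝ) / 10) := by
          refine mul_le_mul_of_nonneg_right ?_ (Real.rpow_nonneg hX0.le _)
          rw [hKker₁]
          have h0 : 0 ≤ A₁c * tailConst M Cs ε₀ κ nd * (40 * π / ε₀) ^ nd := by positivity
          calc A₁c * tailConst M Cs ε₀ κ nd * (40 * π / ε₀) ^ nd = A₁c * tailConst M Cs ε₀ κ nd * (40 * π / ε₀) ^ nd * 1 := (mul_one _).symm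
            _ ≤ A₁c * tailConst M Cs ε₀ κ nd * (40 * π / ε₀) ^ nd * 2 ^ 28 := mul_le_mul_of_nonneg_left (by norm_num) h0
      _ ≤ Kker₁ * (Kf / Lη) := mul_le_mul_of_nonneg_left habsf (by rw [hKker₁]; positivity)
  have hP3 : kernelEps M Cs X U₀ κ nd (X ^ ((1 : ℝ) / 20)) (Real.log η ^ ((1 : ℝ) / 200)) A₁ A₂ A₃ S' ≤
      (Kker₃ + Kker₂) / Lη + Kker₁ * (Kf / Lη) := by
    refine hke.trans ?_
    rw [add_div]
    exact add_le_add (add_le_add hP3a hP3b) hP3c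
  /- ───── P4: the Möbius slots ───── -/
  have hP4 : |S'| * (2 * moebiusSlotErr M X U₀ C₀ (X ^ (-(9 : ℝ) / 10)) 30 + moebiusSlotErr M X U₀ C₀ (X ^ (-(9 : ℝ) / 10)) 30 ^ 2) ≤
      S𝔖 * Kmob * (Kf / Lη) := by
    have hmo := moebiusSlotErr_le_rpow (M := M) hM0 hX1 hε₀ hUlo hUhi (by linarith only [hC₀1] : (0:ℝ) ≤ C₀)
    have hε0 := moebiusSlotErr_nonneg (C₀ := C₀) hM0 hX0.le hU0 (by linarith only [hC₀1]) hτ₀.le 30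
    have h2 := two_mul_add_sq_le hε0 hX1 hmo
    have habsf : X ^ (-(7 : ℝ) / 10) ≤ Kf / Lη := by rw [hXdef]; exact habs_f
    have hS0 : 0 ≤ S𝔖 := (abs_nonneg _).trans hS'le
    have hmc0 : 0 ≤ moebiusErrConst M C₀ ε₀ := moebiusErrConst_nonneg hM0 (by linarith only [hC₀1]) hε₀
    have hKmob0 : 0 ≤ Kmob := by rw [hKmob]; positivity
    calc _ ≤ S𝔖 * ((2 * moebiusErrConst M C₀ ε₀ + moebiusErrConst M C₀ ε₀ ^ 2) * X ^ (-(7 : ℝ) / 10)) :=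
          mul_le_mul hS'le h2 (by positivity) hS0
      _ = S𝔖 * Kmob * X ^ (-(7 : ℝ) / 10) := by rw [hKmob]; ring
      _ ≤ S𝔖 * Kmob * (Kf / Lη) := mul_le_mul_of_nonneg_left habsf (by positivity)
  /- ───── P5: the crude range `n ≤ x₁` ───── -/
  have hP5 : (Bψ ^ 4 * (Int.natAbs ((h₁ : ℤ) - h₂) : ℝ) * (2 * Bψ * B₀ * (ppL ε₀ q x + 1)) ^ 2 *
      (tripleGcdSum 1 (sharpTriples R Dmax)) ^ 2 + |S'|) * (x₁ : ℝ) ≤ x * (Kcru * (Kd / Lη)) := by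
    -- `x₁ ≤ x · x^{-ε₀²}`
    have hx₁ : (x₁ : ℝ) ≤ x * (x : ℝ) ^ (-ε₀ ^ 2) := by
      have h1 : (x₁ : ℝ) ≤ (x : ℝ) ^ (1 - ε₀ ^ 2) := Nat.floor_le (Real.rpow_nonneg hx0.le _)
      rw [show (1 : ℝ) - ε₀ ^ 2 = 1 + (-ε₀ ^ 2) by ring, Real.rpow_add hx0, Real.rpow_one] at h1
      exact h1
    -- `L + 1 ≤ 6X`, `S₁ ≤ 9⁸ (1+X)⁸`
    have hL6 : ppL ε₀ q x + 1 ≤ 6 * X := by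
      show Real.log x + 2 * ppU ε₀ q x + 3 + 1 ≤ 6 * X
      linarith only [hUhi, hX1]
    have hS1 : tripleGcdSum 1 (sharpTriples R Dmax) ≤ 9 ^ 8 * (1 + X) ^ 8 := by
      have h := tripleGcdSum_le_of_le (q := 1) one_ne_zero hR0 hxnat1 hRx (hDx.trans hx2)
      rw [Nat.divisors_one, card_singleton, Nat.cast_one, one_pow, one_mul] at h
      exact h.trans (five_add_four_log_pow_le hx1.le)
    have hS10 : 0 ≤ tripleGcdSum 1 (sharpTriples R Dmax) := tripleGcdSum_nonneg _ _
    have hS0 : 0 ≤ S𝔖 := (abs_nonneg _).trans hS'le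
    have hX2 : X ^ 2 ≤ (1 + X) ^ 2 := pow_le_pow_left₀ hX0.le hX1X 2
    have hone : (1 : ℝ) ≤ (1 + X) ^ 18 := one_le_pow₀ (by linarith only [hX1])
    have hM : Bψ ^ 4 * (Int.natAbs ((h₁ : ℤ) - h₂) : ℝ) * (2 * Bψ * B₀ * (ppL ε₀ q x + 1)) ^ 2 *
        (tripleGcdSum 1 (sharpTriples R Dmax)) ^ 2 + |S'| ≤ Kcru * (1 + X) ^ 18 := by
      have hL0' : 0 ≤ ppL ε₀ q x + 1 := by linarith only [hL0]
      calc Bψ ^ 4 * (Int.natAbs ((h₁ : ℤ) - h₂) : ℝ) * (2 * Bψ * B₀ * (ppL ε₀ q x + 1)) ^ 2 * (tripleGcdSum 1 (sharpTriples R Dmax)) ^ 2 + |S'|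
          ≤ Bψ ^ 4 * (Int.natAbs ((h₁ : ℤ) - h₂) : ℝ) * (2 * Bψ * B₀ * (6 * X)) ^ 2 * (9 ^ 8 * (1 + X) ^ 8) ^ 2 + S𝔖 := by
            gcongr
        _ = Bψ ^ 4 * (Int.natAbs ((h₁ : ℤ) - h₂) : ℝ) * (2 * Bψ * B₀) ^ 2 * 6 ^ 2 * ((9 : ℝ) ^ 8) ^ 2 * (X ^ 2 * (1 + X) ^ 16) + S𝔖 := by ring
        _ ≤ Bψ ^ 4 * (Int.natAbs ((h₁ : ℤ) - h₂) : ℝ) * (2 * Bψ * B₀) ^ 2 * 6 ^ 2 * ((9 : ℝ) ^ 8) ^ 2 * ((1 + X) ^ 2 * (1 + X) ^ 16) + S𝔖 * (1 + X) ^ 18 := by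
            gcongr
            exact le_mul_of_one_le_right hS0 hone
        _ = Kcru * (1 + X) ^ 18 := by rw [hKcru]; ring
    have hKcru0 : 0 ≤ Kcru := by rw [hKcru]; positivity
    have habsd : (1 + X) ^ 18 * (x : ℝ) ^ (-ε₀ ^ 2) ≤ Kd / Lη := by rw [hXdef]; exact habs_d
    have hlhs0 : 0 ≤ Bψ ^ 4 * (Int.natAbs ((h₁ : ℤ) - h₂) : ℝ) * (2 * Bψ * B₀ * (ppL ε₀ q x + 1)) ^ 2 *
        (tripleGcdSum 1 (sharpTriples R Dmax)) ^ 2 + |S'| := by positivity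
    calc _ ≤ (Kcru * (1 + X) ^ 18) * (x * (x : ℝ) ^ (-ε₀ ^ 2)) := mul_le_mul hM hx₁ (Nat.cast_nonneg _) (by positivity)
      _ = x * (Kcru * ((1 + X) ^ 18 * (x : ℝ) ^ (-ε₀ ^ 2))) := by ring
      _ ≤ x * (Kcru * (Kd / Lη)) := by gcongr
  /- ───── P6: Proposition 7.2's error ───── -/
  have hP6 : 3 * (C72 * (x : ℝ) ^ (1 - c)) ≤ x * (3 * C72 * (Ka / Lη)) := by
    have h1 : (x : ℝ) ^ (1 - c) ≤ x * (x : ℝ) ^ (-c') := by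
      rw [show (1 : ℝ) - c = 1 + (-c) by ring, Real.rpow_add hx0, Real.rpow_one]
      exact mul_le_mul_of_nonneg_left (hxpow _ _ (by linarith only [hc'c])) hx0.le
    calc 3 * (C72 * (x : ℝ) ^ (1 - c)) ≤ 3 * (C72 * (x * (x : ℝ) ^ (-c'))) := by gcongr
      _ = x * (3 * C72 * (x : ℝ) ^ (-c')) := by ring
      _ ≤ x * (3 * C72 * (Ka / Lη)) := by gcongr
  /- ───── P7: the singular series ───── -/
  have hP7 : |S' * x - singularSeries H2 * x| ≤ x * ((C𝔖 + 1) * (Ke / Lη)) := by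
    rw [← sub_mul, abs_mul, abs_of_pos hx0, abs_sub_comm, mul_comm]
    refine mul_le_mul_of_nonneg_left (h𝔖x.trans ?_) hx0.le
    have h1 : (1 : ℝ) ≤ x * (Ke / Lη) := by
      calc (1 : ℝ) = x * (x : ℝ) ^ (-(1 : ℝ)) := by rw [Real.rpow_neg_one, mul_inv_cancel₀ hx0.ne']
        _ ≤ x * (Ke / Lη) := mul_le_mul_of_nonneg_left habs_e hx0.le
    calc C𝔖 / x ≤ C𝔖 / x * (x * (Ke / Lη)) := le_mul_of_one_le_right (by positivity) h1
      _ = C𝔖 * (Ke / Lη) := by field_simp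
      _ ≤ (C𝔖 + 1) * (Ke / Lη) := by gcongr; linarith only [show (0:ℝ) ≤ 1 from zero_le_one]
  /- ───── combination ───── -/
  have htot : |∑ n ∈ Icc 1 x, vonMangoldtSiegel χ ψ R (n + h₁) * vonMangoldtSiegel χ ψ R (n + h₂) - singularSeries H2 * x| ≤
      x * ((3 * C72 * Ka + Kχ * (Kb' + Kc) + Kcrt * Kc + (Kker₃ + Kker₂) + (Kker₁ + S𝔖 * Kmob) * Kf + Kcru * Kd +
        (C𝔖 + 1) * Ke) / Lη) := by
    have hB : |∑ n ∈ Icc 1 x, vonMangoldtSiegelSharp χ φ ψ X U₀ R (n + h₁) * vonMangoldtSiegelSharp χ φ ψ X U₀ R (n + h₂) - S' * x| ≤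
        x * (Kχ * (Kb' / Lη + Kc / Lη)) + x * (Kcrt * (Kc / Lη)) +
          (((Kker₃ + Kker₂) / Lη + Kker₁ * (Kf / Lη) + S𝔖 * Kmob * (Kf / Lη)) * x + x * (Kcru * (Kd / Lη))) :=
      hmain.trans (add_le_add (add_le_add (hEχ.trans hP1) hP2) (add_le_add
        (mul_le_mul_of_nonneg_right (add_le_add hP3 hP4) hx0.le) hP5))
    have hA := hflat.trans hP6
    have htri := abs_sub_le (∑ n ∈ Icc 1 x, vonMangoldtSiegel χ ψ R (n + h₁) * vonMangoldtSiegel χ ψ R (n + h₂))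
      (∑ n ∈ Icc 1 x, vonMangoldtSiegelSharp χ φ ψ X U₀ R (n + h₁) * vonMangoldtSiegelSharp χ φ ψ X U₀ R (n + h₂))
      (singularSeries H2 * x)
    have htri2 := abs_sub_le (∑ n ∈ Icc 1 x, vonMangoldtSiegelSharp χ φ ψ X U₀ R (n + h₁) * vonMangoldtSiegelSharp χ φ ψ X U₀ R (n + h₂))
      (S' * x) (singularSeries H2 * x)
    have hR : x * (3 * C72 * (Ka / Lη)) + (x * (Kχ * (Kb' / Lη + Kc / Lη)) + x * (Kcrt * (Kc / Lη)) +
          (((Kker₃ + Kker₂) / Lη + Kker₁ * (Kf / Lη) + S𝔖 * Kmob * (Kf / Lη)) * x + x * (Kcru * (Kd / Lη)))) +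
        x * ((C𝔖 + 1) * (Ke / Lη)) =
        x * ((3 * C72 * Ka + Kχ * (Kb' + Kc) + Kcrt * Kc + (Kker₃ + Kker₂) + (Kker₁ + S𝔖 * Kmob) * Kf + Kcru * Kd +
          (C𝔖 + 1) * Ke) / Lη) := by
      field_simp
      ring
    linarith only [htri, htri2, hA, hB, hP7, hR]
  -- conclusion
  unfold pairAverage
  rw [div_sub' (hx0.ne'), abs_div, abs_of_pos hx0, div_le_iff₀ hx0,
    show (x : ℝ) * singularSeries H2 = singularSeries H2 * x from mul_comm _ _]
  exact htot.trans (le_of_eq (by ring))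

end TaoTeravainen

end Literature.Barriers.Parity
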